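import Literature.NumberTheory.Automorphic.AsaiAtOneRankOne
import Literature.NumberTheory.Automorphic.AsaiSignContOfRawPole
import Literature.NumberTheory.Automorphic.GLOneArchParameterOfAlgebraicCharacter
import Literature.NumberTheory.Automorphic.QuadraticCharacterTwist
import Literature.NumberTheory.Automorphic.ExistsClassFieldCharacterHolds
import Literature.NumberTheory.Automorphic.ClassFieldCharacterFrobenius
import Literature.NumberTheory.GaloisRepresentations.ArtinCharacterReciprocityArchimedeanProofs
import Literature.NumberTheory.GaloisRepresentations.AbsGaloisOuterConj
import HarnessLib

/-!
# Mok's archimedean parity of the Asai sign in rank one: the `GL(1)` stratum of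
# `Mok2014_archimedean_parity_of_asaiSign`, proved

Topic `NumberTheory/Automorphic`; namespace `Literature.NumberTheory.Automorphic`. Proof file
(theorems only: no definition, no named fact, no instance), sibling of `AsaiSign` (the named fact
`Mok2014_archimedean_parity_of_asaiSign`: C. P. Mok, Mem. AMS 235 (2015) no. 1108, Thm. 2.4.10 with
Lemma 2.2.1, Remark 2.2.2 and Cor. 2.5.5, coset form), of `AsaiAtOneRankOne` (Grbac–Shahidi's
Thm. 4.3 at `s = 1` in rank one, by Hecke–Tate theory) and of `AsaiSignContOfRawPole`.

## What is proved

* `Mok2014_archimedean_parity_of_asaiSign_rank_one` (**main**) — the fact **for `N = 1`**, verbatim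
  (every quadratic `E/F` with `c ≠ 1`, every cuspidal datum `P` of `GL₁(𝔸_E)` conjugate self-dual
  almost everywhere with (raw) Asai sign `κ`, every archimedean parameter `χ` of `P`, every complex
  embedding `σ` on which `c` is complex conjugation): every exponent `a ∈ χ σ` lies in
  `(1 - κ)/4 + ℤ`, i.e. `a ∈ ℤ` for `κ = +1` and `a ∈ 1/2 + ℤ` for `κ = -1`.
* `Mok2014_archimedean_parity_of_asaiSign_of_two_le` — consequently the named fact is equivalent to
  its own restriction to ranks `N ≥ 2`.
* `Mok2014_archimedean_parity_of_asaiSignCont_rank_one`, `…Cont_of_two_le` — the same for the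
  continuation-currency twin `Mok2014_archimedean_parity_of_asaiSignCont` (`AsaiSignCont`), through
  `restrict_eq_one_iff_of_hasAsaiPoleCont_rank_one` (identity theorem on `{1 < Re s}`).

In rank one Mok's sign `κ(Π)` of a conjugate self-dual `Π = θ` (a Hecke character of `E` with
`θ ∘ c = θ⁻¹`, i.e. `θ` trivial on `N_{E/F} 𝕀_E`) is the dichotomy `θ|_{𝕀_F} = 1` (`κ = +1`,
`L(s, θ, As⁺) = L(s, θ|_{𝕀_F})` has the pole) versus `θ|_{𝕀_F} = ω_{E/F}` (`κ = -1`; Mok, §2.1 p. 7,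
the sets `𝒵_E^κ` and (2.1.8) `χ_κ(w_c²) = κ`, and Thm. 2.5.4 (a); Gan–Gross–Prasad, Thm. 8.1 in rank one), and the archimedean
component of `θ` at the complex place `w` of `σ` (over the real place `v` of `F`) is
`z ↦ (z/|z|)^m` with `θ|_{𝕀_F, v}(-1) = (-1)^m`; the exponent of `Π_σ` is `a = ± m/2`, and
`ω_{E/F, v} = sgn` at the real place `v` which becomes complex in `E`.  All of this is proved here
from theorems of the tree:

1. *The sign and the restriction* (`partialAsaiL_rank_one_of_apply_smul_mul`,
   `restrict_eq_one_iff_of_hasAsaiPole_rank_one`).  `P` acts through a Hecke character `θ`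
   (`AutomorphicRepData.exists_heckeCharacter_glOne`), conjugate self-duality a.e. and multiplicity
   one for `GL(1)` give `θ · (θ ∘ c) = 1`, hence `θ` is trivial on `A_G` and unitary; Flicker's
   rank-one computation (`eval_asaiLocalPolynomial_rankOne`) gives `L^S(s, P, As^η) =
   ∏_{v ∉ S} (1 - ε_η(v) ψ(ϖ_v) q_v^{-s})⁻¹` with `ψ = θ|_{𝕀_F}`, `ε_+ = 1`, `ε_-(v) = -1` at inert `v`,
   and `L^{S_E}(s, P × P^c) = ζ_E^{S_E}(s)`; Hecke's theorem (`exists_continuation_partialHeckeL_shift`)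
   and Mok's factorisation `ζ_E^{S_E} = L^S(As⁺) L^S(As⁻)` then show: `As⁺` has the pole at `s = 1`
   iff `ψ = 1`, `As⁻` iff `ψ ≠ 1`.  So a raw Asai sign `κ` forces `ψ = 1` (`κ = 1`), `ψ ≠ 1`
   (`κ = -1`).
2. *Class field theory* (`HeckeCharacter.archComponent_neg_one_eq_of_isTrivialOnNormGroup`).  `ψ` is trivial on
   `F^× N_{E/F} 𝕀_E`, a subgroup of index `2` (`index_normGroup_eq_finrank_of_isCyclic`, Tate's Main
   Theorem (B)); if `ψ ≠ 1` it is THE class-field character (`exists_isClassFieldCharacter_holds`),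
   which agrees almost everywhere — hence everywhere — with the Hecke character `μ` attached by
   Artin reciprocity to the quadratic Artin character `χ_{E/F}` (`artinReciprocity_character_holds`,
   `eventually_hasFrobCharpolyAt_quadraticArtinChar`), whose real components are given by
   archimedean reciprocity (`artinReciprocity_character_archimedean_holds`): `μ_v(-1) =
   χ_{E/F}(c_v) = -1` at a real `v` with no real place of `E` above it.
3. *The archimedean dictionary* (`glOne_archParam_of_conjSelfDual`).  The Lie algebra `𝔤𝔩₁(E_∞)`
   acts on the line `W/W'` through a real linear form whose `τ`-projections at the place `w` of `σ`
   are the exponents `p = χ(σ_w)`, `q = χ(σ̄_w)`, with `θ(det(exp a_w, 1)) = e^{a p + ā q}`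
   (`archParameter_clauses_glOne`, `heckeCharacter_glOne_det_ofArch_expMem`); `p - q ∈ ℤ`
   (`exp (2πi)_w = 1`), `p + q = 0` (`c` acts on the exponential ideles at `w` by conjugation,
   `smul_det_ofInfinite_expGL_complexPlace_of_ne_one`, and `θ(c • y) θ(y) = 1`), and
   `θ((-1)_w) = e^{iπ(p - q)}`; finally `((-1)_v)_E = (-1)_w` as `w` is the only place above `v`.

What this does NOT give: the fact for `N ≥ 2` (Mok's second seed Theorem 2.4.10 — the trace
formula — and the archimedean local Langlands correspondence for `GL_N(ℂ)` behind
`HasArchParameter`; see `Mok2014_archimedean_parity_of_asaiSign_of_facts` in `AsaiSignContOfRawPole`).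

## References

* C. P. Mok, *Endoscopic classification of representations of quasi-split unitary groups*,
  Mem. Amer. Math. Soc. 235 (2015), no. 1108: §2.2 (p. 7, `𝒵_E^κ`; Lemma 2.2.1, Remark 2.2.2),
  Thm. 2.5.4 (a), Cor. 2.5.5. [Mok2014]
* W. T. Gan, B. Gross, D. Prasad, *Symplectic local root numbers, central critical `L`-values, and
  restriction problems in the representation theory of classical groups*, Astérisque 346 (2012),
  Thm. 8.1 and Prop. 7.5 (rank one: characters of `E^×/F^×` and of `E^×/N E^×`). [GanGrossPrasad2012]
* J. Tate, *Global class field theory*, Ch. VII of Cassels–Fröhlich (1967), §5.1 Main Theorem (B),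
  §6.3–6.4 (local Artin maps at the real places). [CasselsFrohlichANT1967]
* Y. Flicker, *Twisted tensors and Euler products*, Bull. SMF 116 (1988), pp. 295–306. [Flicker1988]
-/

noncomputable section

open scoped MatrixGroups Matrix Classical NumberField ComplexConjugate Polynomial NNReal
open NumberField NumberField.InfinitePlace NumberField.mixedEmbedding IsDedekindDomain Filter
  Topology

namespace Literature.NumberTheory.Automorphic

open Literature.NumberTheory.GaloisRepresentations

/-! ### Characters of an idèle class group of norm index two -/

section IndexTwo

variable {F E : Type} [Field F] [NumberField F] [Field E] [NumberField E] [Algebra F E]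

/-- **A non-trivial character trivial on a subgroup of index two is the class-field character.**
If `[𝕀_F : F^× N 𝕀_E] = 2`, `ψ ≠ 1` is trivial on the norm group and `η` vanishes exactly on it, then
`ψ = η` (both are the sign character of the group `𝕀_F / F^× N 𝕀_E` of order two).
[cite: CasselsFrohlichANT1967, Ch. VII §5.1 Main Theorem (B)] -/
theorem _root_.Literature.NumberTheory.GaloisRepresentations.HeckeCharacter.eq_of_isTrivialOnNormGroup_of_index_eq_two {ψ η : HeckeCharacter F}
    (hidx : (normGroup F E).index = 2) (hψ : ψ.IsTrivialOnNormGroup E) (hψ1 : ψ ≠ 1)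
    (hη : η.IsClassFieldCharacter E) : ψ = η := by
  obtain ⟨a, ha⟩ := Subgroup.index_eq_two_iff.1 hidx
  have haH : a ∉ normGroup F E := by
    rcases ha 1 with ⟨-, h⟩ | ⟨-, h⟩
    · exact absurd (one_mem _) h
    · rwa [one_mul] at h
  have hmulH : ∀ b, b ∉ normGroup F E → b * a ∈ normGroup F E := fun b hb =>
    (ha b).or.resolve_right hb
  -- a unit of `ℂ` with square `1`, other than `1`, is `-1`
  have hsq : ∀ u : ℂˣ, u * u = 1 → u ≠ 1 → u = -1 := fun u hu hne => by
    have h : (u : ℂ) * u = 1 := by rw [← Units.val_mul, hu, Units.val_one]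
    rcases mul_self_eq_one_iff.1 h with h' | h'
    · exact absurd (Units.ext h') hne
    · exact Units.ext (by rw [h', Units.val_neg, Units.val_one])
  have hηa1 : η a ≠ 1 := fun h => haH ((hη a).1 h)
  have hψa1 : ψ a ≠ 1 := by
    intro h
    apply hψ1
    refine HeckeCharacter.ext fun b => ?_
    by_cases hb : b ∈ normGroup F E
    · rw [hψ b hb, HeckeCharacter.one_apply]
    · have h1 := hψ _ (hmulH b hb)
      rw [map_mul, h, mul_one] at h1
      rw [h1, HeckeCharacter.one_apply]
  have haa : a * a ∈ normGroup F E := hmulH a haH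
  have hψa : ψ a = -1 := hsq _ (by rw [← map_mul]; exact hψ _ haa) hψa1
  have hηa : η a = -1 := hsq _ (by rw [← map_mul]; exact (hη _).2 haa) hηa1
  refine HeckeCharacter.ext fun b => ?_
  by_cases hb : b ∈ normGroup F E
  · rw [hψ b hb, (hη b).2 hb]
  · have h1 := hψ _ (hmulH b hb)
    have h2 := (hη _).2 (hmulH b hb)
    rw [map_mul, hψa, mul_eq_one_iff_eq_inv] at h1
    rw [map_mul, hηa, mul_eq_one_iff_eq_inv] at h2
    rw [h1, h2]

end IndexTwo

/-! ### The class-field character of a quadratic extension at a real place which becomes complex -/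

section RealPlace

variable {F E : Type} [Field F] [NumberField F] [Field E] [NumberField E] [Algebra F E]

/-- **`ω_{E/F, v}(-1) = -1` at a real place `v` of `F` below complex places of `E`**, for any Hecke
character `ψ ≠ 1` of `F` trivial on the norm group `F^× N_{E/F} 𝕀_E` of the quadratic extension
`E/F` (such a `ψ` IS the class-field character `ω_{E/F}`: the norm index is `2`, Tate's Main
Theorem (B); its finite components match those of the Hecke character `μ` of the quadratic Artin
character `χ_{E/F}` given by Artin reciprocity, so `ψ = μ`, and `μ_v(-1) = χ_{E/F}(c_v) = -1` for a
complex conjugation `c_v` at `v` by the archimedean reciprocity law, since `c_v ∉ Γ_E` — otherwise a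
real place of `E` would lie over `v`).
[cite: CasselsFrohlichANT1967, Ch. VII §5.1 Main Theorem (B) and §6.3–6.4] -/
theorem _root_.Literature.NumberTheory.GaloisRepresentations.HeckeCharacter.archComponent_neg_one_eq_of_isTrivialOnNormGroup
    (h2 : Module.finrank F E = 2) {ψ : HeckeCharacter F} (hψ : ψ.IsTrivialOnNormGroup E)
    (hψ1 : ψ ≠ 1) {v : InfinitePlace F} (hv : v.IsReal)
    (hE : ∀ w : InfinitePlace E, w.comap (algebraMap F E) = v → ¬ w.IsReal) :
    ψ.archComponent v (-1) = -1 := by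
  haveI : FiniteDimensional F E := Module.finite_of_finrank_eq_succ h2
  haveI : Algebra.IsQuadraticExtension F E := ⟨h2⟩
  haveI : IsGalois F E := inferInstance
  have hprime : (Module.finrank F E).Prime := by rw [h2]; exact Nat.prime_two
  haveI : Fact (Module.finrank F E).Prime := ⟨hprime⟩
  haveI : IsCyclic (E ≃ₐ[F] E) := isCyclic_of_prime_card (IsGalois.card_aut_eq_finrank F E)
  /- (1) the Hecke character `μ` of the quadratic Artin character, and its real component at `v` -/
  obtain ⟨μ, -, hμ⟩ := artinReciprocity_character_holds F (quadraticArtinChar F E h2)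
  have hμv : μ.archComponent v (-1) = -1 := by
    -- adapted from Summits/…/QuadraticWindowHostInducedRepMemberParity.lean (Literature cannot
    -- import it): a complex conjugation at `v` in `res(Γ_E)` would give a real place above `v`
    obtain ⟨cc, hcc⟩ := exists_isComplexConjugation (InfinitePlace.embedding_of_isReal hv)
    rw [artinReciprocity_character_archimedean_holds F (quadraticArtinChar F E h2) μ hμ v hv cc hcc]
    have hnot : cc ∉ ((absGaloisRestrict F E).range : Subgroup (Field.absoluteGaloisGroup F)) := by
      intro hmem
      have hcc' : IsComplexConjugationAt hv cc := hcc
      rw [isComplexConjugationAt_iff] at hcc'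
      obtain ⟨ι, hι, hιc⟩ := hcc'
      rw [mem_range_absGaloisRestrict_iff_smul_absEmbedding] at hmem
      let φ : E →+* ℂ := ι.comp (absEmbedding F E : E →+* AlgebraicClosure F)
      have hφ : ComplexEmbedding.IsReal φ := by
        rw [ComplexEmbedding.isReal_iff]
        ext1 x
        change star (ι (absEmbedding F E x)) = ι (absEmbedding F E x)
        rw [← hιc.eq]
        exact congrArg ι (hmem x)
      refine hE (InfinitePlace.mk φ) ?_ ⟨φ, hφ, rfl⟩
      rw [InfinitePlace.comap_mk, ← InfinitePlace.mk_embedding v, ← hι.over]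
      congr 1
      ext1 x
      change ι (absEmbedding F E (algebraMap F E x)) = ι (algebraMap F (AlgebraicClosure F) x)
      rw [AlgHom.commutes]
    ext
    rw [Matrix.GeneralLinearGroup.val_det_apply, Matrix.det_fin_one,
      quadraticArtinChar_apply_coe_of_not_mem h2 hnot, Units.val_neg, Units.val_one]
  /- (2) `ψ` is the class-field character `η` (index two) -/
  obtain ⟨η, hη, -⟩ := exists_isClassFieldCharacter_holds (F := F) (E := E)
  have hidx : (normGroup F E).index = 2 :=
    (index_normGroup_eq_finrank_of_isCyclic (F := F) (E := E)).trans h2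
  have hψη : ψ = η := HeckeCharacter.eq_of_isTrivialOnNormGroup_of_index_eq_two hidx hψ hψ1 hη
  /- (3) `η = μ`: both are `ε_{E/F}(v) = ±1` at almost every uniformizer -/
  have hημ : η = μ := by
    refine HeckeCharacter.ext_of_eventually_valueAtUniformizer_eq ?_
    have hunrE : ∀ᶠ u : HeightOneSpectrum (𝓞 F) in cofinite, Algebra.IsUnramifiedIn (𝓞 E) u.asIdeal := by
      rw [Filter.eventually_cofinite]
      exact finite_setOf_not_isUnramifiedIn F E
    filter_upwards [hη.eventually_isPrimitiveRoot_valueAtUniformizer hprime,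
      eventually_hasFrobCharpolyAt_quadraticArtinChar h2, hunrE] with u hu hχu hunr
    have h1 : η.valueAtUniformizer u = quadraticSign E u :=
      valueAtUniformizer_eq_quadraticSign_of_orderOf h2 η hunr hu.eq_orderOf.symm
    -- compare the Frobenius characteristic polynomials of `χ_{E/F}` at a Frobenius above `u`
    -- (adapted from `exists_heckeCharacter_quadraticSign_of_reciprocity_quadraticArtinChar`)
    have h3 : μ.valueAtUniformizer u = quadraticSign E u := by
      obtain ⟨𝔓, h𝔓⟩ := HeightOneSpectrum.primesAbove_nonempty u
      obtain ⟨Φ, hΦ⟩ := HeightOneSpectrum.exists_isArithFrobAt_of_mem_primesAbove_holds h𝔓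
      have e1 := (FramedGaloisRep.hasFrobCharpolyAt_iff_of_rank_one _ u _).mp (hμ u hχu.1).2 𝔓 h𝔓 Φ hΦ
      have e2 := (FramedGaloisRep.hasFrobCharpolyAt_iff_of_rank_one _ u _).mp hχu.2 𝔓 h𝔓 Φ hΦ
      exact e1.symm.trans e2
    rw [h1, h3]
  rw [hψη, hημ, hμv]

end RealPlace

/-! ### The archimedean dictionary for `GL(1)`: exponents of a conjugate self-dual Hecke character -/

section ArchDictionary

variable {F E : Type} [Field F] [NumberField F] [Field E] [NumberField E] [Algebra F E]
  {hcpt : isCompact_glFiniteIntegralLevel 1 E}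

omit [NumberField F] in
/-- **The exponents at `σ` of a `GL₁` datum with conjugate self-dual Hecke character.**  Let
`π = W / W'` be an automorphic representation of `GL₁(𝔸_E)` with Hecke character `χ`
(`r(g) φ - χ(det g) φ ∈ W'`) and archimedean parameter `P`, let `c ≠ 1` be an `F`-automorphism of
`E` with `χ(c • y) χ(y) = 1` for all idèles `y`, and let `σ : E → ℂ` be an embedding on which `c`
is complex conjugation.  Then for an INTEGER `m`: every exponent in `P σ` is `± m/2`, and
`χ((-1)_w) = (-1)^m` at the (complex) place `w` of `σ`.  Proof: `𝔤𝔩₁(E_∞)` acts on the line `W / W'`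
through a real linear form `d` with `χ(det (exp Y, 1)) = e^{d(Y)}`
(`heckeCharacter_glOne_det_ofArch_expMem`), whose `τ`-projections at `w` are the exponents
`p = P(σ_w)`, `q = P(σ̄_w)` (`archParameter_clauses_glOne`), so `χ(det (exp a_w, 1)) = e^{a p + ā q}`;
`e^{2πi (p - q)} = 1` gives `p - q = m ∈ ℤ`; `c` fixes `w` and acts on its exponential idèles by
conjugation (`smul_det_ofInfinite_expGL_complexPlace_of_ne_one`), so conjugate self-duality along
`a = t ∈ ℝ` gives `e^{2t(p + q)} = 1`, `p + q = 0`; and `(-1)_w = det (exp (iπ)_w, 1)` gives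
`χ((-1)_w) = e^{iπ (p - q)} = (-1)^m`.  (Mok, §2.1, p. 7, (2.1.8): `χ_κ(w_c²) = κ`, here at the
archimedean place, `w_c = j`, `j² = -1`; Tate (1950), §2.3, quasi-characters of `ℂˣ`; Clozel 1990, §3.3.)
[cite: Mok2014, §2.1 (2.1.4)–(2.1.8), arXiv p. 7] [cite: Clozel1990, §3.3] -/
theorem glOne_archParam_of_conjSelfDual
    (π : AutomorphicRepData (AutomorphyDatum.gl 1 E hcpt)) {χ : HeckeCharacter E}
    (hχ : ∀ (g : (AdelicGroupData.gl 1 E).Adelic), ∀ φ ∈ π.W,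
      rightTranslation (AdelicGroupData.gl 1 E) g φ -
        ((χ (Matrix.GeneralLinearGroup.det g) : ℂˣ) : ℂ) • φ ∈ π.W')
    {P : (E →+* ℂ) → Multiset ℂ} (hP : π.HasArchParameter P)
    {c : E ≃ₐ[F] E} (hc : c ≠ 1) (hdual : ∀ y : ideleGroup E, χ (c • y) * χ y = 1)
    {σ : E →+* ℂ} (hσ : ComplexEmbedding.IsConj σ c) :
    ∃ m : ℤ, (∀ a ∈ P σ, a = (m : ℂ) / 2 ∨ a = -((m : ℂ) / 2)) ∧
      ((χ (infiniteIdeleSingle (InfinitePlace.mk σ) (-1)) : ℂˣ) : ℂ) = (-1 : ℂ) ^ m := by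
  classical
  -- the place `w₀` of `σ`: complex (it is ramified over `F`), fixed by `c`
  have hram : ¬ IsUnramified F (InfinitePlace.mk σ) := fun h => hc (hσ.isUnramified_mk_iff.1 h)
  have hw : (InfinitePlace.mk σ).IsComplex := (not_isUnramified_iff.1 hram).1
  set w₀ : {w : InfinitePlace E // w.IsComplex} := ⟨InfinitePlace.mk σ, hw⟩ with hw₀
  have hcw : c • w₀.1 = w₀.1 :=
    MulAction.mem_stabilizer_iff.1 ((NumberField.InfinitePlace.mem_stabilizer_mk_iff σ c).2 (Or.inr hσ))
  /- the Lie algebra acts on the line `W / W'` through the real linear form `d'`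
  (adapted from Summits/…/HalfIntegralTwistCM/Negative/ArchParameterGLOne.lean, which Literature
  cannot import) -/
  obtain ⟨ρ, hρ⟩ := π.exists_hasLieAction_gl
  obtain ⟨d', hd'⟩ := π.exists_linearMap_lieAction_eq_smul_one_glOne ρ
  have hlink : ∀ Y : Matrix (Fin 1) (Fin 1) (mixedSpace E),
      ((χ (Matrix.GeneralLinearGroup.det (GLn.ofInfinite 1 E (expGL Y))) : ℂˣ) : ℂ) =
        Complex.exp (d' ⟨Y, trivial⟩) := by
    intro Y
    have h := π.heckeCharacter_glOne_det_ofArch_expMem hχ ⟨Y, trivial⟩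
      (fun φ hφ => π.lieDeriv_sub_smul_mem_of_hasLieAction_glOne hρ hd' ⟨Y, trivial⟩ hφ) 1
    rw [one_smul, Complex.ofReal_one, one_mul] at h
    exact h
  obtain ⟨-, hco⟩ := π.archParameter_clauses_glOne hρ d' hd' hP
  -- the real linear form `L(b) = d'(b_{w₀})` and its decomposition along `τ ∈ {id, conj}`
  let L : ℂ →ₗ[ℝ] ℂ :=
    { toFun := fun b => d' ⟨complexPlaceLie 1 w₀ (b • (1 : Matrix (Fin 1) (Fin 1) ℂ)), trivial⟩
      map_add' := fun b b' => by
        have : complexPlaceLie 1 w₀ ((b + b') • (1 : Matrix (Fin 1) (Fin 1) ℂ)) =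
            complexPlaceLie 1 w₀ (b • (1 : Matrix (Fin 1) (Fin 1) ℂ)) +
              complexPlaceLie 1 w₀ (b' • (1 : Matrix (Fin 1) (Fin 1) ℂ)) := by
          rw [add_smul, map_add]
        rw [← map_add]
        exact congrArg d' (Subtype.ext this)
      map_smul' := fun r b => by
        have : complexPlaceLie 1 w₀ ((r • b) • (1 : Matrix (Fin 1) (Fin 1) ℂ)) =
            r • complexPlaceLie 1 w₀ (b • (1 : Matrix (Fin 1) (Fin 1) ℂ)) := by
          rw [smul_assoc, map_smul]
        rw [RingHom.id_apply, ← map_smul]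
        exact congrArg d' (Subtype.ext this) }
  set p : ℂ := HCEmb.proj (L : ℂ → ℂ) (AlgHom.id ℝ ℂ) 1 with hp
  set q : ℂ := HCEmb.proj (L : ℂ → ℂ) (Complex.conjAe : ℂ →ₐ[ℝ] ℂ) 1 with hq
  have hsum : ∀ a : ℂ, L a = a * p + conj a * q := by
    intro a
    have h := HCEmb.sum_proj (𝕜 := ℂ) L.toAddMonoidHom a
    rw [LinearMap.toAddMonoidHom_coe] at h
    rw [← h]
    obtain ⟨huniv, hne⟩ := univ_algHom_complex_eq
    rw [huniv, Finset.sum_pair hne]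
    have h1 := HCEmb.proj_smul L (AlgHom.id ℝ ℂ) a (1 : ℂ)
    have h2 := HCEmb.proj_smul L (Complex.conjAe : ℂ →ₐ[ℝ] ℂ) a (1 : ℂ)
    rw [smul_eq_mul, mul_one, smul_eq_mul] at h1 h2
    rw [h1, h2]
    rfl
  have hPp : P w₀.1.embedding = {p} := by
    have h := hco w₀ (AlgHom.id ℝ ℂ)
    rwa [algHomId_toRingHom_comp] at h
  have hPq : P (ComplexEmbedding.conjugate w₀.1.embedding) = {q} := by
    have h := hco w₀ (Complex.conjAe : ℂ →ₐ[ℝ] ℂ)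
    rwa [conjAe_toRingHom_comp] at h
  have hval : ∀ a : ℂ, ((χ (Matrix.GeneralLinearGroup.det (GLn.ofInfinite 1 E
      (expGL (complexPlaceLie 1 w₀ (a • (1 : Matrix (Fin 1) (Fin 1) ℂ)))))) : ℂˣ) : ℂ) =
        Complex.exp (a * p + conj a * q) := fun a => by
    rw [hlink, show d' ⟨complexPlaceLie 1 w₀ (a • (1 : Matrix (Fin 1) (Fin 1) ℂ)), trivial⟩ = L a
      from rfl, hsum]
  /- `p - q ∈ ℤ`: the idèle `det (exp (2πi)_{w₀}, 1)` is `1` -/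
  have h2pi : Matrix.GeneralLinearGroup.det (GLn.ofInfinite 1 E (expGL (complexPlaceLie 1 w₀
      ((2 * Real.pi * Complex.I : ℂ) • (1 : Matrix (Fin 1) (Fin 1) ℂ))))) = 1 := by
    refine idele_eq_of_snd_eq_of_extensionEmbedding_eq E ?_ fun w' => ?_
    · rw [det_ofInfinite_snd]
      rfl
    · rw [extensionEmbedding_det_ofInfinite_expGL_complexPlaceLie]
      have h1 : Completion.extensionEmbedding w'
          (((1 : (AdeleRing (𝓞 E) E)ˣ) : AdeleRing (𝓞 E) E).1 w') = 1 := by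
        rw [Units.val_one]
        exact map_one _
      rw [h1]
      split_ifs
      · exact Complex.exp_two_pi_mul_I
      · rfl
  have hexp : Complex.exp (2 * Real.pi * Complex.I * (p - q)) = 1 := by
    have h := hval (2 * Real.pi * Complex.I)
    rw [h2pi, map_one, Units.val_one] at h
    rw [h]
    congr 1
    rw [map_mul, map_mul, Complex.conj_ofReal, Complex.conj_I, map_ofNat]
    ring
  obtain ⟨m, hm'⟩ := Complex.exp_eq_one_iff.1 hexp
  have hm : p - q = m := by
    have h2pi0 : (2 * Real.pi * Complex.I : ℂ) ≠ 0 := by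
      simp [Real.pi_ne_zero, Complex.I_ne_zero]
    exact mul_right_cancel₀ h2pi0 (show (p - q) * (2 * Real.pi * Complex.I) =
      m * (2 * Real.pi * Complex.I) by rw [← hm']; ring)
  /- `p + q = 0`: `c` conjugates the exponential idèles at `w₀`, and `χ(c • y) χ(y) = 1` -/
  have hpq : p + q = 0 := by
    have key : (2 : ℂ) * (p + q) = 0 := by
      refine eq_of_forall_cexp_mul_eq fun t => ?_
      have h := congrArg (fun u : ℂˣ => (u : ℂ)) (hdual (Matrix.GeneralLinearGroup.det
        (GLn.ofInfinite 1 E (expGL (complexPlaceLie 1 w₀ ((t : ℂ) • (1 : Matrix (Fin 1) (Fin 1) ℂ)))))))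
      rw [Units.val_mul, Units.val_one, smul_det_ofInfinite_expGL_complexPlace_of_ne_one F E w₀ hcw hc,
        hval, hval, Complex.conj_conj, Complex.conj_ofReal, ← Complex.exp_add] at h
      rw [mul_zero, Complex.exp_zero, ← h]
      congr 1
      ring
    exact (mul_eq_zero.1 key).resolve_left two_ne_zero
  /- `(-1)_{w₀} = det (exp (iπ)_{w₀}, 1)`, so `χ((-1)_{w₀}) = e^{iπ (p - q)} = (-1)^m` -/
  have hidele : infiniteIdeleSingle w₀.1 (-1) = Matrix.GeneralLinearGroup.det (GLn.ofInfinite 1 E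
      (expGL (complexPlaceLie 1 w₀ (((Real.pi : ℂ) * Complex.I) • (1 : Matrix (Fin 1) (Fin 1) ℂ))))) := by
    refine idele_eq_of_snd_eq_of_extensionEmbedding_eq E ?_ fun w' => ?_
    · rw [det_ofInfinite_snd, infiniteIdeleSingle_snd]
    · rw [extensionEmbedding_det_ofInfinite_expGL_complexPlaceLie]
      by_cases h : w' = w₀.1
      · rw [if_pos h, h, infiniteIdeleSingle_fst_self, Units.val_neg, Units.val_one, map_neg, map_one,
          Complex.exp_pi_mul_I]
      · rw [if_neg h, infiniteIdeleSingle_fst_of_ne _ h, map_one]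
  have hneg : ((χ (infiniteIdeleSingle (InfinitePlace.mk σ) (-1)) : ℂˣ) : ℂ) = (-1 : ℂ) ^ m := by
    rw [show InfinitePlace.mk σ = w₀.1 from rfl, hidele, hval, map_mul, Complex.conj_ofReal,
      Complex.conj_I, show (Real.pi : ℂ) * Complex.I * p + Real.pi * -Complex.I * q =
        (m : ℂ) * (Real.pi * Complex.I) by rw [← hm]; ring,
      Complex.exp_int_mul, Complex.exp_pi_mul_I]
  /- `P σ` is `{p}` or `{q}` according as `σ = σ_{w₀}` or `σ̄_{w₀}` -/
  have hPσ : P σ = {p} ∨ P σ = {q} := by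
    rcases InfinitePlace.mk_eq_iff.mp (InfinitePlace.mk_embedding (InfinitePlace.mk σ)) with h | h
    · left
      rw [← h]
      exact hPp
    · right
      rw [← h]
      exact hPq
  refine ⟨m, fun a ha => ?_, hneg⟩
  have hp2 : p = (m : ℂ) / 2 := by linear_combination (hm + hpq) / 2
  have hq2 : q = -((m : ℂ) / 2) := by linear_combination (hpq - hm) / 2
  rcases hPσ with h | h
  · rw [h, Multiset.mem_singleton] at ha
    exact Or.inl (ha.trans hp2)
  · rw [h, Multiset.mem_singleton] at ha
    exact Or.inr (ha.trans hq2)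

/-- **Base change of `(-1)_v` to the place of `σ`.**  For `σ : E → ℂ` on which the non-trivial
`F`-automorphism `c` of the quadratic extension `E/F` is complex conjugation, the place `w` of `σ`
is the only place of `E` above the real place `v = w|_F`, no place above `v` is real, and
`((-1)_v)_E = (-1)_w` (`ideleBaseChange` is componentwise `F_v → E_w`). [folklore] -/
theorem ideleBaseChange_infiniteIdeleSingle_neg_one_of_isConj (h2 : Module.finrank F E = 2)
    {c : E ≃ₐ[F] E} (hc : c ≠ 1) {σ : E →+* ℂ} (hσ : ComplexEmbedding.IsConj σ c) :
    ((InfinitePlace.mk σ).comap (algebraMap F E)).IsReal ∧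
      (∀ w : InfinitePlace E, w.comap (algebraMap F E) = (InfinitePlace.mk σ).comap (algebraMap F E) →
        w = InfinitePlace.mk σ) ∧
      AdeleRing.ideleBaseChange F E
          (infiniteIdeleSingle ((InfinitePlace.mk σ).comap (algebraMap F E)) (-1)) =
        infiniteIdeleSingle (InfinitePlace.mk σ) (-1) := by
  haveI : Algebra.IsQuadraticExtension F E := ⟨h2⟩
  haveI : IsGalois F E := inferInstance
  have hram : ¬ IsUnramified F (InfinitePlace.mk σ) := fun h => hc (hσ.isUnramified_mk_iff.1 h)
  have hv : ((InfinitePlace.mk σ).comap (algebraMap F E)).IsReal := (not_isUnramified_iff.1 hram).2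
  have hcw : c • InfinitePlace.mk σ = InfinitePlace.mk σ :=
    MulAction.mem_stabilizer_iff.1 ((NumberField.InfinitePlace.mem_stabilizer_mk_iff σ c).2 (Or.inr hσ))
  have huniq : ∀ w : InfinitePlace E,
      w.comap (algebraMap F E) = (InfinitePlace.mk σ).comap (algebraMap F E) → w = InfinitePlace.mk σ := by
    intro w hw
    obtain ⟨τ, rfl⟩ := InfinitePlace.exists_smul_eq_of_comap_eq hw.symm
    rcases AlgEquiv.eq_one_or_eq_of_finrank_eq_two h2 hc τ with rfl | rfl
    · exact one_smul _ _
    · exact hcw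
  refine ⟨hv, huniq, ?_⟩
  -- adapted from Summits/…/QuadraticWindowHostInducedRepMemberArchGLOne.lean
  refine idele_eq_of_snd_eq_of_extensionEmbedding_eq E ?_ fun w' => ?_
  · rw [AdeleRing.coe_ideleBaseChange, AdeleRing.baseChange_snd, infiniteIdeleSingle_snd, map_one,
      infiniteIdeleSingle_snd]
  · rw [extensionEmbedding_ideleBaseChange_fst_apply]
    by_cases h : w'.comap (algebraMap F E) = (InfinitePlace.mk σ).comap (algebraMap F E)
    · have hw' : w' = InfinitePlace.mk σ := huniq w' h
      subst hw'
      simp only [infiniteIdeleSingle_fst_self, Units.val_neg, Units.val_one, map_neg, map_one]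
      split_ifs <;> simp
    · have hne : w' ≠ InfinitePlace.mk σ := fun e => h (by rw [e])
      simp only [infiniteIdeleSingle_fst_of_ne _ h, infiniteIdeleSingle_fst_of_ne _ hne, map_one]
      split_ifs
      · rfl
      · rfl

end ArchDictionary

/-! ### Conjugate self-duality in rank one: `θ · (θ ∘ c) = 1` and the restriction to `𝕀_F` -/

section ConjSelfDual

variable {F E : Type} [Field F] [NumberField F] [Field E] [NumberField E] [Algebra F E]
  {hcpt : isCompact_glFiniteIntegralLevel 1 E}

omit [NumberField F] in
/-- **Conjugate self-duality almost everywhere is `θ(c • y) θ(y) = 1` in rank one.**  If the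
`GL₁` datum `π` with Hecke character `θ` is conjugate self-dual at almost every place on Satake
parameters (`t_{π, c w} = t_{π, w}⁻¹`), then `(θ ∘ c) · θ = 1`: the Satake parameter of `π` at `w`
is `{θ(ϖ_w)}` (`eventually_hasSatakeParamAt_glOne`), so `(θ ∘ c)(ϖ_w) θ(ϖ_w) = θ(ϖ_{c w}) θ(ϖ_w) = 1`
at almost every `w`, and a Hecke character is determined by almost all of its values at
uniformizers (`HeckeCharacter.ext_of_eventually_valueAtUniformizer_eq`, multiplicity one for
`GL(1)`).  (Mok, §2.1 p. 7, the set `𝒵_E` of conjugate self-dual characters `χ ∘ c = χ⁻¹`; §2.2–2.3: `Π^c ≅ Π^∨`.)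
[cite: Mok2014, §2.1 (2.1.4), arXiv p. 7]
[cite: CasselsFrohlichANT1967, Ch. VII §4 Prop. 4.1 (proof)] -/
theorem AutomorphicRepData.apply_smul_mul_apply_eq_one_of_isConjSelfDualAE
    (π : AutomorphicRepData (AutomorphyDatum.gl 1 E hcpt)) {θ : HeckeCharacter E}
    (hθ : ∀ (g : (AdelicGroupData.gl 1 E).Adelic), ∀ φ ∈ π.W,
      rightTranslation (AdelicGroupData.gl 1 E) g φ -
        ((θ (Matrix.GeneralLinearGroup.det g) : ℂˣ) : ℂ) • φ ∈ π.W')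
    {c : E ≃ₐ[F] E} (hcsd : π.IsConjSelfDualAE c) (y : ideleGroup E) : θ (c • y) * θ y = 1 := by
  obtain ⟨θc, hθc⟩ := θ.exists_galConj c
  have hone : θc * θ = 1 := by
    refine HeckeCharacter.ext_of_eventually_valueAtUniformizer_eq ?_
    have hur : ∀ᶠ w : HeightOneSpectrum (𝓞 E) in cofinite, θ.IsUnramifiedAt w :=
      θ.finite_ramifiedPlaces_iff.1 (HeckeCharacter.finite_ramifiedPlaces_holds _)
    have hsat : ∀ᶠ w : HeightOneSpectrum (𝓞 E) in cofinite,
        π.HasSatakeParamAt w {θ.valueAtUniformizer w} := by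
      filter_upwards [π.eventually_hasSatakeParamAt_glOne hθ] with w hw
      exact hw _ (HeckeCharacter.valued_uniformizer (K := E) (v := w))
    have hinj : Function.Injective fun w : HeightOneSpectrum (𝓞 E) => c • w := MulAction.injective c
    have hur' := hinj.tendsto_cofinite.eventually hur
    have hsat' := hinj.tendsto_cofinite.eventually hsat
    filter_upwards [hcsd, hsat, hsat', hur'] with w hw hs hs' hu'
    have key := hw _ _ hs hs'
    rw [Multiset.map_singleton, Multiset.singleton_inj] at key
    have hne : θ.valueAtUniformizer w ≠ 0 := by
      rw [HeckeCharacter.valueAtUniformizer]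
      exact Units.ne_zero _
    have h1 : (1 : HeckeCharacter E).valueAtUniformizer w = 1 := by
      rw [HeckeCharacter.valueAtUniformizer, HeckeCharacter.localComponent_apply,
        HeckeCharacter.one_apply, Units.val_one]
    rw [HeckeCharacter.valueAtUniformizer_mul, HeckeCharacter.valueAtUniformizer_galConj hθc hu', key,
      inv_mul_cancel₀ hne, h1]
  have h := congrArg (fun χ : HeckeCharacter E => χ y) hone
  simpa only [HeckeCharacter.mul_apply, hθc, HeckeCharacter.one_apply] using h

omit [NumberField F] in
/-- **A conjugate self-dual character is trivial on `A_G` (hence unitary).**  `c` fixes the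
positive real idèles `z(r)` (`smul_posRealIdele`), so `θ(z(r))² = 1`, and `z(r) = z(√r)²`.
[folklore] -/
theorem _root_.Literature.NumberTheory.GaloisRepresentations.HeckeCharacter.map_posRealIdele_eq_one_of_apply_smul_mul {θ : HeckeCharacter E}
    {c : E ≃ₐ[F] E} (hdual : ∀ y : ideleGroup E, θ (c • y) * θ y = 1) (r : ℝ≥0ˣ) :
    θ (posRealIdele E r) = 1 := by
  have hsq : ∀ t : ℝ≥0ˣ, θ (posRealIdele E t) * θ (posRealIdele E t) = 1 := fun t => by
    have h := hdual (posRealIdele E t)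
    rwa [smul_posRealIdele] at h
  set t : ℝ≥0ˣ := Units.mk0 (NNReal.sqrt (r : ℝ≥0)) (by
    rw [Ne, NNReal.sqrt_eq_zero]
    exact r.ne_zero) with ht
  have hr : r = t * t := Units.ext (by simp [ht])
  rw [hr, map_mul, map_mul]
  exact hsq t

/-- **The restriction to `𝕀_F` of a conjugate self-dual character is trivial on the norm group
`F^× N_{E/F} 𝕀_E`** (`E/F` quadratic, `c ≠ 1`): on principal idèles as a Hecke character, and on
`x` with `x_E = N y = y · (c • y)` because `θ(y) θ(c • y) = 1`. [folklore] -/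
theorem _root_.Literature.NumberTheory.GaloisRepresentations.HeckeCharacter.isTrivialOnNormGroup_restrict_of_apply_smul_mul
    (h2 : Module.finrank F E = 2) {c : E ≃ₐ[F] E} (hc : c ≠ 1) {θ : HeckeCharacter E}
    (hdual : ∀ y : ideleGroup E, θ (c • y) * θ y = 1)
    {ψ : HeckeCharacter F} (hψ : ∀ x, ψ x = θ (AdeleRing.ideleBaseChange F E x)) :
    ψ.IsTrivialOnNormGroup E := by
  intro x hx
  obtain ⟨y, hy, z, hz, rfl⟩ := Subgroup.mem_sup.1 hx
  rw [map_mul, ψ.map_principal hy, one_mul, hψ]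
  obtain ⟨y', hy'⟩ := mem_idelicNormSubgroup_iff.1 hz
  rw [← hy', ideleGalNorm_eq_mul_smul h2 hc, map_mul, mul_comm]
  exact hdual y'

end ConjSelfDual

/-! ### The Asai sign of a conjugate self-dual Hecke character: `κ = +1` iff `θ|_{𝕀_F} = 1` -/

section RankOneSign

variable {F E : Type} [Field F] [NumberField F] [Field E] [NumberField E] [Algebra F E]
  {hcpt : isCompact_glFiniteIntegralLevel 1 E}

/-- **The partial Asai `L`-functions of a conjugate self-dual Hecke character near `s = 1`.**
Let `π` be a `GL₁(𝔸_E)` datum with Hecke character `θ`, `θ(c • y) θ(y) = 1`, let `ψ = θ|_{𝕀_F}` and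
let `(S, A)` be an Asai datum of `π`.  Then there are `δ > 0` and `G₊`, `G₋` holomorphic on
`{1 < Re s} ∪ B(1, δ)`, non-zero at `s = 1`, with, for `Re s > 1`,
`L^S(s, π, As⁺) = G₊(s) / (s - 1)^k` and `L^S(s, π, As⁻) = G₋(s) / (s - 1)^{1 - k}`, where `k = 1` if
`ψ = 1` and `k = 0` otherwise.  Indeed `θ` is trivial on `A_G` and unitary, `L^S(s, π, As⁺) =
L_F^S(s, ψ)` and `L^{S_E}(s, π × π^c) = ζ_E^{S_E}(s)` factor by factor (Flicker's rank-one
computation, `eval_asaiLocalPolynomial_rankOne`, `eval_satakePairPolynomial_rankOne`), both continued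
by Hecke's theorem (`exists_continuation_partialHeckeL_shift`), and `L^S(As⁻) = ζ_E^{S_E} / L^S(As⁺)`
by Mok's factorisation (`IsAsaiDatum.partialPairL_smul_eq_partialAsaiL_mul`) — the order count of
Grbac–Shahidi's proof (p. 206) in rank one.  (Mok, §2.1 p. 7 and Thm. 2.5.4 (a): in rank one the
sign is read off `θ|_{𝔸_F^×} ∈ {1, ω_{E/F}}`, the partition `𝒵_E = 𝒵_E^+ ⊔ 𝒵_E^-`.) [cite: Mok2014, §2.5, factorisation before Thm. 2.5.4]
[cite: GrbacShahidi2015, proof of Thm. 4.3, p. 206] [cite: Flicker1988, pp. 305–306] -/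
theorem partialAsaiL_rank_one_of_apply_smul_mul
    (h2 : Module.finrank F E = 2) {c : E ≃ₐ[F] E} (hc : c ≠ 1)
    (π : AutomorphicRepData (AutomorphyDatum.gl 1 E hcpt)) {θ : HeckeCharacter E}
    (hθ : ∀ (g : (AdelicGroupData.gl 1 E).Adelic), ∀ φ ∈ π.W,
      rightTranslation (AdelicGroupData.gl 1 E) g φ -
        ((θ (Matrix.GeneralLinearGroup.det g) : ℂˣ) : ℂ) • φ ∈ π.W')
    (hdual : ∀ y : ideleGroup E, θ (c • y) * θ y = 1)
    {ψ : HeckeCharacter F} (hψ : ∀ x, ψ x = θ (AdeleRing.ideleBaseChange F E x))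
    {S : Set (HeightOneSpectrum (𝓞 F))} {A : SatakeFamily E} (hSA : π.IsAsaiDatum c S A) :
    ∃ (δ : ℝ) (Gp Gm : ℂ → ℂ), 0 < δ ∧
      DifferentiableOn ℂ Gp ({s : ℂ | 1 < s.re} ∪ Metric.ball 1 δ) ∧
      DifferentiableOn ℂ Gm ({s : ℂ | 1 < s.re} ∪ Metric.ball 1 δ) ∧ Gp 1 ≠ 0 ∧ Gm 1 ≠ 0 ∧
      ∀ s : ℂ, 1 < s.re →
        partialAsaiL S c A 1 s = Gp s / (s - 1) ^ (if ψ = 1 then 1 else 0) ∧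
        partialAsaiL S c A (-1) s = Gm s / (s - 1) ^ (if ψ = 1 then 0 else 1) := by
  haveI : Algebra.IsQuadraticExtension F E := { finrank_eq_two' := h2 }
  haveI : FiniteDimensional F E := Module.finite_of_finrank_eq_succ h2
  /- Step 1: Satake parameters above `v ∉ S` are `{θ(ϖ_w)}`, `θ` unramified there -/
  have hAθ : ∀ w : HeightOneSpectrum (𝓞 E), w.under (𝓞 F) ∉ S →
      A w = {θ.valueAtUniformizer w} ∧ θ.IsUnramifiedAt w := fun w hw =>
    ⟨π.eq_singleton_valueAtUniformizer_glOne hθ (hSA.hasSatakeParamAt hw),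
      π.isUnramifiedAt_heckeCharacter_glOne' hθ (hSA.hasSatakeParamAt hw)⟩
  /- Step 2: `θ` is trivial on `A_G`, hence unitary; no twist by the norm is needed -/
  have hθA : ∀ r : ℝ≥0ˣ, θ (posRealIdele E r) = 1 :=
    HeckeCharacter.map_posRealIdele_eq_one_of_apply_smul_mul hdual
  have hθu : θ.IsUnitary := HeckeCharacter.isUnitary_of_map_posRealIdele hθA
  have hν : ∀ x : ideleGroup E, (((1 : HeckeCharacter E) x : ℂˣ) : ℂ) = ((ideleNorm x : ℝ) : ℂ) ^ (0 : ℂ) :=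
    fun x => by rw [HeckeCharacter.one_apply, Units.val_one, Complex.cpow_zero]
  have hθ1 : θ = θ * 1 := (mul_one θ).symm
  /- Step 3: the restriction `ψ = θ|_{𝕀_F}`: unitary, trivial on `A_G`, unramified off `S` -/
  have hψu : ψ.IsUnitary := fun x => by rw [hψ]; exact hθu _
  have hψA : ∀ t : ℝ≥0ˣ, ψ (posRealIdele F t) = 1 := fun t => by
    rw [hψ, AdeleRing.ideleBaseChange_posRealIdele]
    exact hθA t
  have hunrv : ∀ v ∉ S, ∀ w : HeightOneSpectrum (𝓞 E), w.under (𝓞 F) = v → θ.IsUnramifiedAt w :=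
    fun v hv w hw => (hAθ w (by rw [hw]; exact hv)).2
  have hψur : ∀ v ∉ S, ψ.IsUnramifiedAt v := fun v hv =>
    HeckeCharacter.isUnramifiedAt_restrict hψ _ (HeightOneSpectrum.mem_pair_placeAbove_iff h2 hc v)
      (hunrv v hv)
  /- Step 4: `Θ = θ · (θ ∘ c) = 1`, the character of the pair `(π, π^c)` -/
  obtain ⟨θc, hθc⟩ := θ.exists_galConj c
  have hΘ : θ * θc = 1 := HeckeCharacter.ext fun y => by
    rw [HeckeCharacter.mul_apply, hθc, mul_comm, hdual, HeckeCharacter.one_apply]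
  have h1u : (1 : HeckeCharacter E).IsUnitary := fun x => by
    rw [HeckeCharacter.one_apply, Units.val_one, norm_one]
  have h1A : ∀ t : ℝ≥0ˣ, (1 : HeckeCharacter E) (posRealIdele E t) = 1 := fun _ => rfl
  set SE : Set (HeightOneSpectrum (𝓞 E)) := {w | w.under (𝓞 F) ∈ S} with hSEdef
  have hSE : SE.Finite := finite_setOf_under_mem hSA.finite
  have h1ur : ∀ w ∉ SE, (1 : HeckeCharacter E).IsUnramifiedAt w := fun _ _ _ => rfl
  /- Step 5: the Euler factors of `As^η` and of the pair, place by place -/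
  set ε : ℤˣ → HeightOneSpectrum (𝓞 F) → ℂ := fun η v =>
    if c • placeAbove E v = placeAbove E v then (((η : ℤ) : ℂ)) else 1 with hεdef
  have hε : ∀ η v, ‖ε η v‖ ≤ 1 := fun η v => by
    simp only [hεdef]
    split_ifs
    · exact norm_intCast_units_le_one η
    · simp
  have hε1 : ∀ v, ε 1 v = 1 := fun v => by simp [hεdef]
  have hq : ∀ v : HeightOneSpectrum (𝓞 F), (v.residueCard : ℂ) ≠ 0 := fun v =>
    Nat.cast_ne_zero.mpr (ne_of_gt (lt_trans zero_lt_one v.one_lt_residueCard))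
  have hAsaiFactor : ∀ (η : ℤˣ) (s : ℂ) (v : {v : HeightOneSpectrum (𝓞 F) // v ∉ S}),
      ((asaiLocalPolynomial c A η (placeAbove E v.1)).eval ((v.1.residueCard : ℂ) ^ (-s)))⁻¹ =
        (1 - ε η v.1 * ψ.valueAtUniformizer v.1 * ((v.1.residueCard : ℂ) ^ (-s)))⁻¹ := by
    intro η s v
    rw [eval_asaiLocalPolynomial_rankOne h2 hc hν hθ1 hψ (fun w hw => (hAθ w (by rw [hw]; exact v.2)).1)
      (hunrv v.1 v.2) (fun w hw hcw => hSA.inertiaDeg_eq_two (by rw [hw]; exact v.2) hcw) η,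
      mul_zero, neg_zero, Complex.cpow_zero, mul_one]
  have hPairFactor : ∀ (s : ℂ) (w : {w : HeightOneSpectrum (𝓞 E) // w ∉ SE}),
      ((satakePairPolynomial (A w.1) (A (c • w.1))).eval ((w.1.residueCard : ℂ) ^ (-s)))⁻¹ =
        (1 - (1 : ℂ) * (1 : HeckeCharacter E).valueAtUniformizer w.1 * ((w.1.residueCard : ℂ) ^ (-s)))⁻¹ := by
    intro s w
    have hw : w.1.under (𝓞 F) ∉ S := w.2
    have hcw : (c • w.1).under (𝓞 F) ∉ S := by rwa [HeightOneSpectrum.under_algEquiv_smul F E c w.1]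
    rw [eval_satakePairPolynomial_rankOne (F := F) hν hθ1 hθc (hAθ w.1 hw).1 (hAθ (c • w.1) hcw).1
      ((hAθ (c • w.1) hcw).2), hΘ, mul_zero, neg_zero, Complex.cpow_zero, mul_one, one_mul]
  -- the partial `L`-functions as Hecke Euler products (all `s`)
  have hLeq : ∀ (η : ℤˣ) (s : ℂ), partialAsaiL S c A η s =
      ∏' v : {v : HeightOneSpectrum (𝓞 F) // v ∉ S},
        (1 - ε η v.1 * ψ.valueAtUniformizer v.1 * ((v.1.residueCard : ℂ) ^ (-s)))⁻¹ :=
    fun η s => tprod_congr fun v => hAsaiFactor η s v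
  have hReq : ∀ s : ℂ, partialPairL SE A (fun w => A (c • w)) s =
      ∏' w : {w : HeightOneSpectrum (𝓞 E) // w ∉ SE},
        (1 - (1 : ℂ) * (1 : HeckeCharacter E).valueAtUniformizer w.1 * ((w.1.residueCard : ℂ) ^ (-s)))⁻¹ :=
    fun s => tprod_congr fun w => hPairFactor s w
  -- multipliability on `Re s > 1`, non-vanishing of `L^S(s, π, As⁺)` there, Mok's factorisation
  have hmulA : ∀ (η : ℤˣ) (s : ℂ), 1 < s.re →
      Multipliable fun v : {v : HeightOneSpectrum (𝓞 F) // v ∉ S} =>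
        ((asaiLocalPolynomial c A η (placeAbove E v.1)).eval ((v.1.residueCard : ℂ) ^ (-s)))⁻¹ := by
    intro η s hs
    rw [show (fun v : {v : HeightOneSpectrum (𝓞 F) // v ∉ S} =>
        ((asaiLocalPolynomial c A η (placeAbove E v.1)).eval ((v.1.residueCard : ℂ) ^ (-s)))⁻¹) =
        fun v => (1 - ε η v.1 * ψ.valueAtUniformizer v.1 * ((v.1.residueCard : ℂ) ^ (-s)))⁻¹
        from funext (hAsaiFactor η s)]
    exact multipliable_twistedEulerFactor hψu S (hε η) hs
  have hmulP : ∀ s : ℂ, 1 < s.re →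
      Multipliable fun w : {w : HeightOneSpectrum (𝓞 E) // w.under (𝓞 F) ∉ S} =>
        ((satakePairPolynomial (A w.1) (A (c • w.1))).eval ((w.1.residueCard : ℂ) ^ (-s)))⁻¹ := by
    intro s hs
    rw [show (fun w : {w : HeightOneSpectrum (𝓞 E) // w.under (𝓞 F) ∉ S} =>
        ((satakePairPolynomial (A w.1) (A (c • w.1))).eval ((w.1.residueCard : ℂ) ^ (-s)))⁻¹) =
        fun w => (1 - (1 : ℂ) * (1 : HeckeCharacter E).valueAtUniformizer w.1 *
          ((w.1.residueCard : ℂ) ^ (-s)))⁻¹ from funext (hPairFactor s)]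
    exact multipliable_twistedEulerFactor (ε := fun _ => 1) h1u SE (fun _ => by simp) hs
  have hLne : ∀ s : ℂ, 1 < s.re → partialAsaiL S c A 1 s ≠ 0 := fun s hs => by
    rw [hLeq 1 s]
    exact tprod_twistedEulerFactor_ne_zero hψu S (hε 1) hs
  have hfac : ∀ s : ℂ, 1 < s.re →
      partialPairL SE A (fun w => A (c • w)) s = partialAsaiL S c A 1 s * partialAsaiL S c A (-1) s :=
    fun s hs => hSA.partialPairL_smul_eq_partialAsaiL_mul h2 hc (hmulP s hs) (hmulA 1 s hs) (hmulA (-1) s hs)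
  /- Step 6: Hecke–Tate continuations of `L^S(s, π, As⁺) = L_F^S(s, ψ)` and of `ζ_E^{S_E}` -/
  obtain ⟨kp, δp, Gp, hkp, hδp, hGpd, hGpeq, hGp1⟩ :=
    exists_continuation_partialHeckeL_shift ψ hψu hψA hSA.finite hψur (τ := 0) Complex.zero_re
  obtain ⟨kR, δR, GR, hkR, hδR, hGRd, hGReq, hGR1⟩ :=
    exists_continuation_partialHeckeL_shift (1 : HeckeCharacter E) h1u h1A hSE h1ur (τ := 0)
      Complex.zero_re
  have hkp' : kp = if ψ = 1 then 1 else 0 := by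
    rw [hkp]
    by_cases h : ψ = 1 <;> simp [h]
  have hkR1 : kR = 1 := by rw [hkR, if_pos ⟨rfl, rfl⟩]
  have hGpL : ∀ s : ℂ, 1 < s.re → Gp s = (s - 1) ^ kp * partialAsaiL S c A 1 s := fun s hs => by
    rw [hGpeq s hs, hLeq 1 s]
    congr 1
    exact tprod_congr fun v => by rw [hε1, one_mul, add_zero]
  have hGRL : ∀ s : ℂ, 1 < s.re → GR s = (s - 1) * partialPairL SE A (fun w => A (c • w)) s :=
    fun s hs => by
    rw [hGReq s hs, hReq s, hkR1, pow_one]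
    congr 1
    exact tprod_congr fun w => by rw [one_mul, add_zero]
  /- Step 7: `As⁻ = ζ_E^{S_E} / As⁺` on `{1 < Re s} ∪ B(1, δ)`, where `Gp ≠ 0` -/
  have hU : ({s : ℂ | 1 < s.re} ∪ Metric.ball 1 δp) ∈ 𝓝 (1 : ℂ) :=
    (isOpen_one_lt_re_union_ball δp).mem_nhds (Or.inr (Metric.mem_ball_self hδp))
  obtain ⟨δ₀, hδ₀, hGp0⟩ : ∃ δ₀ > 0, ∀ z : ℂ, dist z 1 < δ₀ → Gp z ≠ 0 :=
    Metric.eventually_nhds_iff.mp (((hGpd.continuousOn.continuousAt hU).eventually_ne hGp1))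
  set δ : ℝ := min δp (min δR δ₀) with hδdef
  have hδ : 0 < δ := lt_min hδp (lt_min hδR hδ₀)
  have hUp : {s : ℂ | 1 < s.re} ∪ Metric.ball (1 : ℂ) δ ⊆ {s : ℂ | 1 < s.re} ∪ Metric.ball 1 δp :=
    Set.union_subset_union_right _ (Metric.ball_subset_ball (min_le_left _ _))
  have hUR : {s : ℂ | 1 < s.re} ∪ Metric.ball (1 : ℂ) δ ⊆ {s : ℂ | 1 < s.re} ∪ Metric.ball 1 δR :=
    Set.union_subset_union_right _ (Metric.ball_subset_ball ((min_le_right _ _).trans (min_le_left _ _)))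
  have hGpne : ∀ z ∈ {s : ℂ | 1 < s.re} ∪ Metric.ball (1 : ℂ) δ, Gp z ≠ 0 := by
    rintro z (hz | hz)
    · have hz' : 1 < z.re := hz
      rw [hGpL z hz']
      have hz1 : z - 1 ≠ 0 := fun h => by
        rw [sub_eq_zero] at h; rw [h, Complex.one_re] at hz'; exact lt_irrefl _ hz'
      exact mul_ne_zero (pow_ne_zero _ hz1) (hLne z hz')
    · exact hGp0 z (lt_of_lt_of_le (Metric.mem_ball.mp hz) ((min_le_right _ _).trans (min_le_right _ _)))
  refine ⟨δ, Gp, fun s => GR s / Gp s, hδ, hGpd.mono hUp, (hGRd.mono hUR).div (hGpd.mono hUp) hGpne,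
    hGp1, div_ne_zero hGR1 hGp1, fun s hs => ?_⟩
  have hs1 : s - 1 ≠ 0 := fun h => by
    rw [sub_eq_zero] at h; rw [h, Complex.one_re] at hs; exact lt_irrefl _ hs
  have hGps : Gp s ≠ 0 := hGpne s (Or.inl hs)
  have hLp : partialAsaiL S c A 1 s = Gp s / (s - 1) ^ kp := by
    rw [hGpL s hs, mul_div_cancel_left₀ _ (pow_ne_zero _ hs1)]
  have hLm : partialAsaiL S c A (-1) s =
      partialPairL SE A (fun w => A (c • w)) s / partialAsaiL S c A 1 s := by
    rw [hfac s hs, mul_div_cancel_left₀ _ (hLne s hs)]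
  have hPair : partialPairL SE A (fun w => A (c • w)) s = GR s / (s - 1) := by
    rw [hGRL s hs, mul_div_cancel_left₀ _ hs1]
  refine ⟨by rw [hLp, hkp'], ?_⟩
  rw [hLm, hPair, hLp, hkp']
  by_cases h : ψ = 1
  · rw [if_pos h, if_pos h, pow_one, pow_zero, div_one, div_div_div_cancel_right₀ hs1]
  · rw [if_neg h, if_neg h, pow_zero, pow_one, div_one]
    field_simp

/-- **The Asai pole of a conjugate self-dual Hecke character sits at `As⁺` iff `θ|_{𝕀_F} = 1`.**
For a `GL₁(𝔸_E)` datum `π` with Hecke character `θ`, `θ(c • y) θ(y) = 1`, and `ψ = θ|_{𝕀_F}`: if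
`L^S(s, π, As^η)` has a (raw) pole at `s = 1` (`HasAsaiPole c η`), then `ψ = 1 ↔ η = 1` — a raw
pole is incompatible with a holomorphic continuation at `s = 1`
(`not_tendsto_of_tendsto_sub_one_mul`), and by `partialAsaiL_rank_one_of_apply_smul_mul` the member
of the pair `As^±` that is holomorphic at `1` is `As⁻` if `ψ = 1` and `As⁺` if `ψ ≠ 1`.  (Mok, Thm.
2.5.4 (a) with §2.1 p. 7, in rank one; Gan–Gross–Prasad, Thm. 8.1.) [cite: Mok2014, Thm. 2.5.4 (a)]
[cite: GanGrossPrasad2012, Thm. 8.1] -/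
theorem restrict_eq_one_iff_of_hasAsaiPole_rank_one
    (h2 : Module.finrank F E = 2) {c : E ≃ₐ[F] E} (hc : c ≠ 1)
    (π : AutomorphicRepData (AutomorphyDatum.gl 1 E hcpt)) {θ : HeckeCharacter E}
    (hθ : ∀ (g : (AdelicGroupData.gl 1 E).Adelic), ∀ φ ∈ π.W,
      rightTranslation (AdelicGroupData.gl 1 E) g φ -
        ((θ (Matrix.GeneralLinearGroup.det g) : ℂˣ) : ℂ) • φ ∈ π.W')
    (hdual : ∀ y : ideleGroup E, θ (c • y) * θ y = 1)
    {ψ : HeckeCharacter F} (hψ : ∀ x, ψ x = θ (AdeleRing.ideleBaseChange F E x))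
    {η : ℤˣ} (hpole : π.HasAsaiPole c η) : ψ = 1 ↔ η = 1 := by
  obtain ⟨S, A, hSA⟩ := π.exists_isAsaiDatum h2 hc
  obtain ⟨δ, Gp, Gm, hδ, hGpd, hGmd, -, -, hL⟩ :=
    partialAsaiL_rank_one_of_apply_smul_mul h2 hc π hθ hdual hψ hSA
  obtain ⟨r, hr, hrt⟩ := hpole hSA
  have hU : ({s : ℂ | 1 < s.re} ∪ Metric.ball 1 δ) ∈ 𝓝 (1 : ℂ) :=
    (isOpen_one_lt_re_union_ball δ).mem_nhds (Or.inr (Metric.mem_ball_self hδ))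
  -- a raw pole at `η` excludes `L^S(s, π, As^η) = G(s)` near `1⁺` with `G` continuous at `1`
  have key : ∀ {G : ℂ → ℂ}, DifferentiableOn ℂ G ({s : ℂ | 1 < s.re} ∪ Metric.ball 1 δ) →
      (∀ s : ℂ, 1 < s.re → partialAsaiL S c A η s = G s) → False := by
    intro G hGd hGL
    have hcont : ContinuousAt G 1 := (hGd.differentiableAt hU).continuousAt
    have hlim : Tendsto (partialAsaiL S c A η) (𝓝[{s : ℂ | 1 < s.re}] 1) (𝓝 (G 1)) := by
      refine (hcont.tendsto.mono_left nhdsWithin_le_nhds).congr' ?_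
      filter_upwards [self_mem_nhdsWithin] with s hs
      exact (hGL s hs).symm
    exact not_tendsto_of_tendsto_sub_one_mul hr hrt (G 1) hlim
  rcases Int.units_eq_one_or η with rfl | rfl
  · refine ⟨fun _ => rfl, fun _ => ?_⟩
    by_contra hψ1
    refine key hGpd fun s hs => ?_
    rw [(hL s hs).1, if_neg hψ1, pow_zero, div_one]
  · refine ⟨fun hψ1 => ?_, fun h => absurd h (by decide)⟩
    exfalso
    refine key hGmd fun s hs => ?_
    rw [(hL s hs).2, if_pos hψ1, pow_zero, div_one]

/-- **Continuation form of `restrict_eq_one_iff_of_hasAsaiPole_rank_one`.**  If the CONTINUED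
partial Asai `L`-function `L^S(s, π, As^η)` has its simple pole at `s = 1` (`HasAsaiPoleCont c η`: a
function `G` holomorphic on `{1/2 < Re s}` with `G = (s - 1) L^S` far to the right and `G(1) ≠ 0`),
then again `ψ = 1 ↔ η = 1`: were `L^S(s, π, As^η) = G_η(s)` on `{1 < Re s}` with `G_η` holomorphic at
`1` (`partialAsaiL_rank_one_of_apply_smul_mul`), the identity theorem on the half-plane `{1 < Re s}`
would give `G = (s - 1) G_η` there, whence `G(1) = lim_{s → 1⁺} (s - 1) G_η(s) = 0`.
(Mok, Thm. 2.5.4 (a) in rank one; Grbac–Shahidi 2015, Thm. 4.3 (2).) [cite: Mok2014, Thm. 2.5.4 (a)]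
[cite: GrbacShahidi2015, Thm. 4.3 (2)] -/
theorem restrict_eq_one_iff_of_hasAsaiPoleCont_rank_one
    (h2 : Module.finrank F E = 2) {c : E ≃ₐ[F] E} (hc : c ≠ 1)
    (π : AutomorphicRepData (AutomorphyDatum.gl 1 E hcpt)) {θ : HeckeCharacter E}
    (hθ : ∀ (g : (AdelicGroupData.gl 1 E).Adelic), ∀ φ ∈ π.W,
      rightTranslation (AdelicGroupData.gl 1 E) g φ -
        ((θ (Matrix.GeneralLinearGroup.det g) : ℂˣ) : ℂ) • φ ∈ π.W')
    (hdual : ∀ y : ideleGroup E, θ (c • y) * θ y = 1)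
    {ψ : HeckeCharacter F} (hψ : ∀ x, ψ x = θ (AdeleRing.ideleBaseChange F E x))
    {η : ℤˣ} (hpole : π.HasAsaiPoleCont c η) : ψ = 1 ↔ η = 1 := by
  obtain ⟨S, A, hSA⟩ := π.exists_isAsaiDatum h2 hc
  obtain ⟨δ, Gp, Gm, hδ, hGpd, hGmd, -, -, hL⟩ :=
    partialAsaiL_rank_one_of_apply_smul_mul h2 hc π hθ hdual hψ hSA
  obtain ⟨σ₀, -, -, G, hGd, hGL, hG1⟩ := hpole hSA
  -- a continued pole at `η` excludes `L^S(s, π, As^η) = G'(s)` on `{1 < Re s}`, `G'` holomorphic at `1`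
  have key : ∀ {G' : ℂ → ℂ}, DifferentiableOn ℂ G' ({s : ℂ | 1 < s.re} ∪ Metric.ball 1 δ) →
      (∀ s : ℂ, 1 < s.re → partialAsaiL S c A η s = G' s) → False := by
    intro G' hG'd hG'L
    set V : Set ℂ := {s : ℂ | 1 < s.re} with hV
    have hVo : IsOpen V := isOpen_lt continuous_const Complex.continuous_re
    -- `G = (s - 1) G'` on `V`: both are holomorphic there and they agree on `Re s > max σ₀ 1`
    have hΦd : DifferentiableOn ℂ (fun s => (s - 1) * G' s) V :=
      (differentiableOn_id.sub (differentiableOn_const _)).mul (hG'd.mono Set.subset_union_left)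
    have hGdV : DifferentiableOn ℂ G V := hGd.mono fun s hs => by
      simp only [hV, Set.mem_setOf_eq] at hs ⊢
      linarith
    set s₀ : ℂ := ((max σ₀ 1 + 1 : ℝ) : ℂ) with hs₀
    have hs₀V : s₀ ∈ V := by
      simp only [hV, hs₀, Set.mem_setOf_eq, Complex.ofReal_re]
      linarith [le_max_right σ₀ 1]
    have hagree : G =ᶠ[𝓝 s₀] fun s => (s - 1) * G' s := by
      have hWo : IsOpen {s : ℂ | max σ₀ 1 < s.re} := isOpen_lt continuous_const Complex.continuous_re
      have hs₀W : s₀ ∈ {s : ℂ | max σ₀ 1 < s.re} := by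
        simp only [hs₀, Set.mem_setOf_eq, Complex.ofReal_re]
        linarith
      filter_upwards [hWo.mem_nhds hs₀W] with s hs
      have hs' : max σ₀ 1 < s.re := hs
      rw [hGL s (lt_of_le_of_lt (le_max_left _ _) hs'),
        hG'L s (lt_of_le_of_lt (le_max_right _ _) hs')]
    have hEqOn : Set.EqOn G (fun s => (s - 1) * G' s) V :=
      (hGdV.analyticOnNhd hVo).eqOn_of_preconnected_of_eventuallyEq (hΦd.analyticOnNhd hVo)
        (convex_halfSpace_re_gt _).isPreconnected hs₀V hagree
    -- at `s = 1`: `G → G(1)` and `(s - 1) G' → 0` along `Re s → 1⁺`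
    have hU : ({s : ℂ | 1 < s.re} ∪ Metric.ball 1 δ) ∈ 𝓝 (1 : ℂ) :=
      (isOpen_one_lt_re_union_ball δ).mem_nhds (Or.inr (Metric.mem_ball_self hδ))
    have hcont' : ContinuousAt G' 1 := (hG'd.differentiableAt hU).continuousAt
    have hcont : ContinuousAt G 1 :=
      (hGd.differentiableAt ((isOpen_lt continuous_const Complex.continuous_re).mem_nhds
        (by simp only [Set.mem_setOf_eq, Complex.one_re]; norm_num))).continuousAt
    have hlim0 : Tendsto (fun s => (s - 1) * G' s) (𝓝[V] 1) (𝓝 0) := by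
      have h := tendsto_sub_one_nhdsWithin_one_lt_re.mul (hcont'.tendsto.mono_left nhdsWithin_le_nhds)
      rwa [zero_mul] at h
    have hlimG : Tendsto G (𝓝[V] 1) (𝓝 0) :=
      hlim0.congr' (by filter_upwards [self_mem_nhdsWithin] with s hs; exact (hEqOn hs).symm)
    have hlimG' : Tendsto G (𝓝[V] 1) (𝓝 (G 1)) := hcont.tendsto.mono_left nhdsWithin_le_nhds
    exact hG1 (tendsto_nhds_unique hlimG' hlimG)
  rcases Int.units_eq_one_or η with rfl | rfl
  · refine ⟨fun _ => rfl, fun _ => ?_⟩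
    by_contra hψ1
    refine key hGpd fun s hs => ?_
    rw [(hL s hs).1, if_neg hψ1, pow_zero, div_one]
  · refine ⟨fun hψ1 => ?_, fun h => absurd h (by decide)⟩
    exfalso
    refine key hGmd fun s hs => ?_
    rw [(hL s hs).2, if_pos hψ1, pow_zero, div_one]

/-- **The parity of the exponents from the sign dichotomy of the restriction** (the common tail of
the raw and continued forms).  For a `GL₁(𝔸_E)` datum `π` with Hecke character `θ`,
`θ(c • y) θ(y) = 1`, restriction `ψ = θ|_{𝕀_F}` with `ψ = 1 ↔ κ = 1`, archimedean parameter `P` and an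
embedding `σ` on which `c` is complex conjugation: every `a ∈ P σ` lies in `(1 - κ)/4 + ℤ`.  The
exponents at `σ` are `± m/2` with `θ((-1)_w) = (-1)^m = ψ_v(-1)` (`glOne_archParam_of_conjSelfDual`,
`ideleBaseChange_infiniteIdeleSingle_neg_one_of_isConj`); `κ = 1`: `ψ = 1`, `m` even; `κ = -1`:
`ψ ≠ 1` is the class-field character, `ψ_v(-1) = -1`
(`HeckeCharacter.archComponent_neg_one_eq_of_isTrivialOnNormGroup`), `m` odd.
[cite: Mok2014, §2.1 (2.1.8), arXiv p. 7, and Cor. 2.5.5] -/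
theorem archParity_rank_one_of_restrict_iff
    (h2 : Module.finrank F E = 2) {c : E ≃ₐ[F] E} (hc : c ≠ 1)
    (π : AutomorphicRepData (AutomorphyDatum.gl 1 E hcpt)) {θ : HeckeCharacter E}
    (hθ : ∀ (g : (AdelicGroupData.gl 1 E).Adelic), ∀ φ ∈ π.W,
      rightTranslation (AdelicGroupData.gl 1 E) g φ -
        ((θ (Matrix.GeneralLinearGroup.det g) : ℂˣ) : ℂ) • φ ∈ π.W')
    (hdual : ∀ y : ideleGroup E, θ (c • y) * θ y = 1)
    {ψ : HeckeCharacter F} (hψ : ∀ x, ψ x = θ (AdeleRing.ideleBaseChange F E x))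
    {κ : ℤˣ} (hiff : ψ = 1 ↔ κ = 1) {P : (E →+* ℂ) → Multiset ℂ} (hP : π.HasArchParameter P)
    {σ : E →+* ℂ} (hσ : NumberField.ComplexEmbedding.IsConj σ c) :
    ∀ a ∈ P σ, ∃ m : ℤ, a = (m : ℂ) + (((1 : ℕ) : ℂ) - 1) / 2 + (1 - ((κ : ℤ) : ℂ)) / 4 := by
  intro a ha
  -- the archimedean dictionary at `σ`
  obtain ⟨m, hm, hneg⟩ := glOne_archParam_of_conjSelfDual π hθ hP hc hdual hσ
  obtain ⟨hv, huniq, hbc⟩ := ideleBaseChange_infiniteIdeleSingle_neg_one_of_isConj h2 hc hσ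
  have hψv : ((ψ.archComponent ((InfinitePlace.mk σ).comap (algebraMap F E)) (-1) : ℂˣ) : ℂ) =
      (-1 : ℂ) ^ m := by
    rw [HeckeCharacter.archComponent_apply, hψ, hbc, hneg]
  have heven : ∀ k : ℤ, (-1 : ℂ) ^ (2 * k) = 1 := fun k => by
    rw [zpow_mul, zpow_two, neg_one_mul, neg_neg, one_zpow]
  have hodd : ∀ k : ℤ, (-1 : ℂ) ^ (2 * k + 1) = -1 := fun k => by
    rw [zpow_add₀ (neg_ne_zero.2 one_ne_zero), heven, zpow_one, one_mul]
  simp only [Nat.cast_one, sub_self, zero_div, add_zero]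
  rcases Int.units_eq_one_or κ with rfl | rfl
  · -- `κ = +1`: `ψ = 1`, `(-1)^m = 1`, `m` even, `a = ± m/2 ∈ ℤ`
    have hψ1 : ψ = 1 := hiff.2 rfl
    rw [hψ1, HeckeCharacter.archComponent_one, MonoidHom.one_apply, Units.val_one] at hψv
    obtain ⟨k, hk | hk⟩ := Int.even_or_odd' m
    · rcases hm a ha with h | h
      · refine ⟨k, ?_⟩
        rw [h, hk]
        push_cast
        ring
      · refine ⟨-k, ?_⟩
        rw [h, hk]
        push_cast
        ring
    · rw [hk, hodd] at hψv
      norm_num at hψv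
  · -- `κ = -1`: `ψ ≠ 1` is the class-field character, `ψ_v(-1) = -1`, `m` odd, `a ∈ 1/2 + ℤ`
    have hψ1 : ψ ≠ 1 := fun h => absurd (hiff.1 h) (by decide)
    have hψN : ψ.IsTrivialOnNormGroup E :=
      HeckeCharacter.isTrivialOnNormGroup_restrict_of_apply_smul_mul h2 hc hdual hψ
    have hram : ¬ IsUnramified F (InfinitePlace.mk σ) := fun h => hc (hσ.isUnramified_mk_iff.1 h)
    have hw : (InfinitePlace.mk σ).IsComplex := (not_isUnramified_iff.1 hram).1
    have hE : ∀ w : InfinitePlace E, w.comap (algebraMap F E) =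
        (InfinitePlace.mk σ).comap (algebraMap F E) → ¬ w.IsReal := fun w hw' => by
      rw [huniq w hw']
      exact not_isReal_iff_isComplex.2 hw
    have h := HeckeCharacter.archComponent_neg_one_eq_of_isTrivialOnNormGroup h2 hψN hψ1 hv hE
    rw [h, Units.val_neg, Units.val_one] at hψv
    obtain ⟨k, hk | hk⟩ := Int.even_or_odd' m
    · rw [hk, heven] at hψv
      norm_num at hψv
    · rcases hm a ha with h' | h'
      · refine ⟨k, ?_⟩
        rw [h', hk]
        push_cast
        ring
      · refine ⟨-k - 1, ?_⟩
        rw [h', hk]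
        push_cast
        ring

end RankOneSign

/-! ### The theorem -/

section Main

/-- **Mok 2014, archimedean parity of the Asai sign, for `GL(1)`: the rank-one stratum of the named
fact `Mok2014_archimedean_parity_of_asaiSign`, proved.**  For a quadratic extension `E/F` of number
fields with non-trivial automorphism `c`, a cuspidal automorphic representation datum `P` of
`GL₁(𝔸_E)` (Borel–Jacquet) which is conjugate self-dual almost everywhere and has (raw) Asai sign
`κ` (`L^S(s, P, As^κ)` has the pole at `s = 1`), an archimedean parameter `χ` of `P` and a complex
embedding `σ` of `E` on which `c` is complex conjugation: every `a ∈ χ σ` satisfies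
`a ∈ (1 - κ)/4 + ℤ` — verbatim the conclusion of the fact for `N = 1` (its regularity and coset
hypotheses are not needed in rank one).

`P` acts through a Hecke character `θ` with `θ(c • y) θ(y) = 1`
(`apply_smul_mul_apply_eq_one_of_isConjSelfDualAE`); its exponents at `σ` are `± m/2` with
`θ((-1)_w) = (-1)^m` (`glOne_archParam_of_conjSelfDual`), and `θ((-1)_w) = ψ_v(-1)` for the
restriction `ψ = θ|_{𝕀_F}` and the real place `v` of `F` below the place `w` of `σ`
(`ideleBaseChange_infiniteIdeleSingle_neg_one_of_isConj`).  By
`restrict_eq_one_iff_of_hasAsaiPole_rank_one`, `κ = +1` forces `ψ = 1`, so `m` is even and `a ∈ ℤ`;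
`κ = -1` forces `ψ ≠ 1`, so `ψ` — trivial on the norm group — is the class-field character of `E/F`
and `ψ_v(-1) = -1` (`archComponent_neg_one_eq_of_isTrivialOnNormGroup`), `m` is odd and
`a ∈ 1/2 + ℤ`.  This is Mok's Cor. 2.5.5 (with Thm. 2.4.10, Lemma 2.2.1, Remark 2.2.2) in rank one,
where Thm. 2.4.10 reduces to `θ|_{𝔸_F^×} ∈ {1, ω_{E/F}}` (Mok, §2.1 p. 7, `𝒵_E^κ` and (2.1.8)
`χ_κ(w_c²) = κ`; Gan–Gross–Prasad Thm. 8.1) and the parity of `z ↦ (z/|z|)^m` is `(-1)^m` ((2.2.6)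
with `A = I`).
[cite: Mok2014, Thm. 2.4.10, Lemma 2.2.1, Remark 2.2.2 and Cor. 2.5.5; §2.1 (2.1.4)–(2.1.8), arXiv p. 7]
[cite: GanGrossPrasad2012, Thm. 8.1] [cite: CasselsFrohlichANT1967, Ch. VII §5.1 and §6.3–6.4] -/
theorem Mok2014_archimedean_parity_of_asaiSign_rank_one
    (F E : Type) [Field F] [NumberField F] [Field E] [NumberField E] [Algebra F E] (c : E ≃ₐ[F] E)
    (h2 : Module.finrank F E = 2) (hc : c ≠ 1) (hcpt : isCompact_glFiniteIntegralLevel 1 E)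
    (P : CuspidalAutomorphicRepData 1 E hcpt) (κ : ℤˣ) (χ : (E →+* ℂ) → Multiset ℂ) (σ : E →+* ℂ)
    (hcsd : P.1.IsConjSelfDualAE c) (hsign : P.1.HasAsaiSign c κ) (hχ : P.1.HasArchParameter χ)
    (hσ : NumberField.ComplexEmbedding.IsConj σ c) :
    ∀ a ∈ χ σ, ∃ m : ℤ, a = (m : ℂ) + (((1 : ℕ) : ℂ) - 1) / 2 + (1 - ((κ : ℤ) : ℂ)) / 4 := by
  -- the Hecke character of `P`, conjugate self-dual, its restriction to `𝕀_F`, and the sign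
  obtain ⟨θ, hθ⟩ := P.1.exists_heckeCharacter_glOne
  have hdual : ∀ y : ideleGroup E, θ (c • y) * θ y = 1 :=
    P.1.apply_smul_mul_apply_eq_one_of_isConjSelfDualAE hθ hcsd
  obtain ⟨ψ, hψ⟩ := θ.exists_restrict F
  have hpole : P.1.HasAsaiPole c κ := (P.1.hasAsaiSign_iff_of_odd odd_one c κ).1 hsign
  exact archParity_rank_one_of_restrict_iff h2 hc P.1 hθ hdual hψ
    (restrict_eq_one_iff_of_hasAsaiPole_rank_one h2 hc P.1 hθ hdual hψ hpole) hχ hσ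

/-- **The named fact reduced to ranks `N ≥ 2`.**  `Mok2014_archimedean_parity_of_asaiSign` follows
from its own restriction to cuspidal data of rank `N ≥ 2`, the rank-one stratum being the theorem
`Mok2014_archimedean_parity_of_asaiSign_rank_one`.  (What remains is Mok's Thm. 2.4.10 — the second
seed theorem, proved by the trace formula — at the archimedean places, together with the archimedean
local Langlands correspondence for `GL_N(ℂ)`, `N ≥ 2`.)
[cite: Mok2014, Thm. 2.4.10, Lemma 2.2.1, Remark 2.2.2 and Cor. 2.5.5] -/
theorem Mok2014_archimedean_parity_of_asaiSign_of_two_le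
    (h : ∀ (F E : Type) [Field F] [NumberField F] [Field E] [NumberField E] [Algebra F E]
      (c : E ≃ₐ[F] E), Module.finrank F E = 2 → c ≠ 1 →
      ∀ (N : ℕ) (hcpt : isCompact_glFiniteIntegralLevel N E) (P : CuspidalAutomorphicRepData N E hcpt)
        (κ : ℤˣ) (χ : (E →+* ℂ) → Multiset ℂ) (σ : E →+* ℂ) (r : ℝ),
        2 ≤ N → P.1.IsConjSelfDualAE c → P.1.HasAsaiSign c κ → P.1.HasArchParameter χ →
        NumberField.ComplexEmbedding.IsConj σ c → (χ σ).Nodup →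
        (∀ a ∈ χ σ, ∃ m : ℤ, a = (m : ℂ) + (r : ℂ)) →
        ∀ a ∈ χ σ, ∃ m : ℤ, a = (m : ℂ) + ((N : ℂ) - 1) / 2 + (1 - ((κ : ℤ) : ℂ)) / 4) :
    Mok2014_archimedean_parity_of_asaiSign := by
  intro F E _ _ _ _ _ c h2 hc N hcpt P κ χ σ r hN hcsd hsign hχ hσ hnd hcos
  rcases Nat.lt_or_ge N 2 with hN2 | hN2
  · obtain rfl : N = 1 := by omega
    exact Mok2014_archimedean_parity_of_asaiSign_rank_one F E c h2 hc hcpt P κ χ σ hcsd hsign hχ hσ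
  · exact h F E c h2 hc N hcpt P κ χ σ r hN2 hcsd hsign hχ hσ hnd hcos

/-- **Mok 2014, archimedean parity of the Asai sign, for `GL(1)`, continuation currency: the
rank-one stratum of the named fact `Mok2014_archimedean_parity_of_asaiSignCont` (`AsaiSignCont`),
proved.**  Same statement as `Mok2014_archimedean_parity_of_asaiSign_rank_one` with the raw Asai sign
replaced by the sign of the CONTINUED partial Asai `L`-functions (`HasAsaiSignCont c κ`); same proof,
through `restrict_eq_one_iff_of_hasAsaiPoleCont_rank_one`.
[cite: Mok2014, Thm. 2.4.10, Lemma 2.2.1, Remark 2.2.2 and Cor. 2.5.5; §2.1 (2.1.4)–(2.1.8), arXiv p. 7]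
[cite: GanGrossPrasad2012, Thm. 8.1] [cite: CasselsFrohlichANT1967, Ch. VII §5.1 and §6.3–6.4] -/
theorem Mok2014_archimedean_parity_of_asaiSignCont_rank_one
    (F E : Type) [Field F] [NumberField F] [Field E] [NumberField E] [Algebra F E] (c : E ≃ₐ[F] E)
    (h2 : Module.finrank F E = 2) (hc : c ≠ 1) (hcpt : isCompact_glFiniteIntegralLevel 1 E)
    (P : CuspidalAutomorphicRepData 1 E hcpt) (κ : ℤˣ) (χ : (E →+* ℂ) → Multiset ℂ) (σ : E →+* ℂ)
    (hcsd : P.1.IsConjSelfDualAE c) (hsign : P.1.HasAsaiSignCont c κ) (hχ : P.1.HasArchParameter χ)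
    (hσ : NumberField.ComplexEmbedding.IsConj σ c) :
    ∀ a ∈ χ σ, ∃ m : ℤ, a = (m : ℂ) + (((1 : ℕ) : ℂ) - 1) / 2 + (1 - ((κ : ℤ) : ℂ)) / 4 := by
  obtain ⟨θ, hθ⟩ := P.1.exists_heckeCharacter_glOne
  have hdual : ∀ y : ideleGroup E, θ (c • y) * θ y = 1 :=
    P.1.apply_smul_mul_apply_eq_one_of_isConjSelfDualAE hθ hcsd
  obtain ⟨ψ, hψ⟩ := θ.exists_restrict F
  have hpole : P.1.HasAsaiPoleCont c κ := by
    have h1 : ((-1 : ℤˣ) ^ (1 + 1)) = 1 := (odd_one.add_one).neg_one_pow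
    have e : ((-1 : ℤˣ) ^ (1 + 1)) * κ = κ := by rw [h1, one_mul]
    exact (congrArg (P.1.HasAsaiPoleCont c) e).mp ((P.1.hasAsaiSignCont_iff c κ).1 hsign)
  exact archParity_rank_one_of_restrict_iff h2 hc P.1 hθ hdual hψ
    (restrict_eq_one_iff_of_hasAsaiPoleCont_rank_one h2 hc P.1 hθ hdual hψ hpole) hχ hσ

/-- **The continuation-currency fact reduced to ranks `N ≥ 2`.**
`Mok2014_archimedean_parity_of_asaiSignCont` follows from its own restriction to cuspidal data of
rank `N ≥ 2`, the rank-one stratum being `Mok2014_archimedean_parity_of_asaiSignCont_rank_one`.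
[cite: Mok2014, Thm. 2.4.10, Lemma 2.2.1, Remark 2.2.2 and Cor. 2.5.5] -/
theorem Mok2014_archimedean_parity_of_asaiSignCont_of_two_le
    (h : ∀ (F E : Type) [Field F] [NumberField F] [Field E] [NumberField E] [Algebra F E]
      (c : E ≃ₐ[F] E), Module.finrank F E = 2 → c ≠ 1 →
      ∀ (N : ℕ) (hcpt : isCompact_glFiniteIntegralLevel N E) (P : CuspidalAutomorphicRepData N E hcpt)
        (κ : ℤˣ) (χ : (E →+* ℂ) → Multiset ℂ) (σ : E →+* ℂ) (r : ℝ),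
        2 ≤ N → P.1.IsConjSelfDualAE c → P.1.HasAsaiSignCont c κ → P.1.HasArchParameter χ →
        NumberField.ComplexEmbedding.IsConj σ c → (χ σ).Nodup →
        (∀ a ∈ χ σ, ∃ m : ℤ, a = (m : ℂ) + (r : ℂ)) →
        ∀ a ∈ χ σ, ∃ m : ℤ, a = (m : ℂ) + ((N : ℂ) - 1) / 2 + (1 - ((κ : ℤ) : ℂ)) / 4) :
    Mok2014_archimedean_parity_of_asaiSignCont := by
  intro F E _ _ _ _ _ c h2 hc N hcpt P κ χ σ r hN hcsd hsign hχ hσ hnd hcos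
  rcases Nat.lt_or_ge N 2 with hN2 | hN2
  · obtain rfl : N = 1 := by omega
    exact Mok2014_archimedean_parity_of_asaiSignCont_rank_one F E c h2 hc hcpt P κ χ σ hcsd hsign hχ hσ
  · exact h F E c h2 hc N hcpt P κ χ σ r hN2 hcsd hsign hχ hσ hnd hcos

end Main

end Literature.NumberTheory.Automorphic

end
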